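import Summits.CriticalPhenomena.PercolationContinuityZ3.Theorems.PercNearOneGluingNoHeavyLowerTailSahiE3MajPatternFlows
import Mathlib.Data.Fintype.Pi
import Mathlib.Data.Fin.VecNotation
import Mathlib.Tactic.Linarith
import Mathlib.Tactic.FinCases
import HarnessLib
import HarnessLib.Audit

/-!
# `NoHeavyLowerTail` (crux stmt-CriticalPhenomena-4575), Sahi programme P4 (Holley / monotone coupling):
# the maj-slot certificate on the pattern `2³` — combinatorial interface,
      appendix: the consequences of log-supermodularity (facts)

Support file (cell `prim-l12`, seat P4, generation 9; `--supports stmt-CriticalPhenomena-4575`).  No named facts,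
      no sorries; standard
axioms; def-free; no notation (the slot set is passed as `(M, hM : M = {110, 101, 011,
      111})`).  Notation and context as in `…SahiE3MajPatternRows`.

`…SahiE3PatternCertificate.latticeE3_nonneg_of_patternCertificate` reduces Sahi's `C₃` for the slot `↑(j₁⊔j₂) ∪
      ↑(j₁⊔j₃) ∪ ↑(j₂⊔j₃)`
(every finite distributive lattice, every FKG weight) to a FLOW CERTIFICATE `(R, Fl)` for `(MAJ, ν)`,
      `ν` the pattern measure.
* `certificate_of_ineqs` turns that into FINITELY MANY REAL INEQUALITIES,
      homogeneous of degree three in the eight masses and the total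
  mass `Z` (kept as a symbol): nonnegativity of `r`, caps `r_t ≤ Z(Z+d)n_t`, the three single-atom Hall inequalities,
        `Σ r = Z²u`,
  up-transport of the seven nonempty traces,
        and the 28 pair inequalities `need(S,S') ≤ r(S∩S'∩MAJ)` for the saturated up-sets
  `{⊤}, ↑(xy), ↑x` — the canonical 47-item list displayed in the statement (flows by `dominance` + Strassen,
        pairs by `pair_all`).
* `facts_of_pattern`: the consequences of log-supermodularity on `2³` consumed by the real-algebra files
      `…SahiE3MajCert*`:
  nonnegativity, `Z = Σ n`, nine point conditions, nine FKG products of principal up-sets (four functions theorem),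
        three
  Ahlswede–Daykin trace inequalities.
The existence of `r01, r02, r12, rT` satisfying the list is `…SahiE3MajCore.exists_cert` (four regimes, memo HOME
prim-l12-p4/FROM-prim-l12-p4-gen8-PATTERN-CERTIFICATES.md §4b, gen-9 memo FROM-prim-l12-p4-gen9-MAJ-SLOT-LEAN.md);
the lattice theorem is `…SahiE3MajSlot`.
-/

namespace Summit.CriticalPhenomena.PercolationContinuityZ3.Theorems.SahiE3MajPattern

open Finset
open scoped BigOperators


/-- **The consequences of log-supermodularity on `2³` used by the real-algebra files** (`…SahiE3MajCert*`):
      nonnegativity,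
the nine point conditions (incomparable pairs), nine FKG products of principal up-sets (four functions theorem
[Ahlswede–Daykin] via `fkg_upperSet_mass`, `Z` = total mass),
      and the three Ahlswede–Daykin trace inequalities `u·n_x ≤ d·n(↑x ∩ MAJ)`
(`…SahiE3PatternReduction.mass_U_mul_trace_compl_le`). [this work] -/
theorem facts_of_pattern (ν : (Fin 3 → Bool) → ℝ) (hν0 : ∀ t, 0 ≤ ν t) (hν : ∀ a b, ν a * ν b ≤ ν (a ⊓ b) * ν (a ⊔ b))
    (nE n0 n1 n2 n01 n02 n12 nT Z : ℝ) (hZ : ∑ t, ν t = Z)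
    (hE : ν ![false, false, false] = nE) (h0 : ν ![true, false, false] = n0) (h1 : ν ![false, true,
          false] = n1) (h2 : ν ![false, false, true] = n2)
    (h01 : ν ![true, true, false] = n01) (h02 : ν ![true, false, true] = n02) (h12 : ν ![false, true,
          true] = n12) (hT : ν ![true, true, true] = nT) :
      0 ≤ nE ∧
      0 ≤ n0 ∧
      0 ≤ n1 ∧
      0 ≤ n2 ∧
      0 ≤ n01 ∧
      0 ≤ n02 ∧
      0 ≤ n12 ∧
      0 ≤ nT ∧
      0 ≤ Z ∧
      Z = nE + n0 + n1 + n2 + n01 + n02 + n12 + nT ∧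
      n0 * n1 ≤ nE * n01 ∧
      n0 * n2 ≤ nE * n02 ∧
      n1 * n2 ≤ nE * n12 ∧
      n0 * n12 ≤ nE * nT ∧
      n1 * n02 ≤ nE * nT ∧
      n2 * n01 ≤ nE * nT ∧
      n01 * n02 ≤ n0 * nT ∧
      n01 * n12 ≤ n1 * nT ∧
      n02 * n12 ≤ n2 * nT ∧
      (n0 + n01 + n02 + nT) * (n1 + n01 + n12 + nT) ≤ Z * (n01 + nT) ∧
      (n0 + n01 + n02 + nT) * (n2 + n02 + n12 + nT) ≤ Z * (n02 + nT) ∧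
      (n1 + n01 + n12 + nT) * (n2 + n02 + n12 + nT) ≤ Z * (n12 + nT) ∧
      (n01 + nT) * (n02 + nT) ≤ Z * nT ∧
      (n01 + nT) * (n12 + nT) ≤ Z * nT ∧
      (n02 + nT) * (n12 + nT) ≤ Z * nT ∧
      (n01 + nT) * (n2 + n02 + n12 + nT) ≤ Z * nT ∧
      (n02 + nT) * (n1 + n01 + n12 + nT) ≤ Z * nT ∧
      (n12 + nT) * (n0 + n01 + n02 + nT) ≤ Z * nT ∧
      (n01 + n02 + n12 + nT) * n0 ≤ (nE + n0 + n1 + n2) * (n01 + n02 + nT) ∧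
      (n01 + n02 + n12 + nT) * n1 ≤ (nE + n0 + n1 + n2) * (n01 + n12 + nT) ∧
      (n01 + n02 + n12 + nT) * n2 ≤ (nE + n0 + n1 + n2) * (n02 + n12 + nT) := by
  letI : DecidableLE (Fin 3 → Bool) := fun a b => inferInstanceAs (Decidable (∀ i, a i ≤ b i))
  have hν0' : 0 ≤ ν := fun t => hν0 t
  -- point conditions
  have pt : ∀ a b c d : Fin 3 → Bool, a ⊓ b = c → a ⊔ b = d → ν a * ν b ≤ ν c * ν d := by
    rintro a b c d rfl rfl; exact hν a b
  have hUc : (({![true, true, false], ![true, false, true], ![false, true, true], ![true, true,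
        true]} : Finset (Fin 3 → Bool)))ᶜ = ({![false, false, false], ![true, false, false], ![false, true, false],
        ![false, false, true]} : Finset (Fin 3 → Bool)) := by decide
  have huniv : (univ : Finset (Fin 3 → Bool)) = {![false, false, false], ![true, false, false], ![false, true,
        false], ![false, false, true], ![true, true, false], ![true, false, true], ![false, true, true], ![true,
        true, true]} := by decide
  have hZ' : Literature.Probability.LatticeModels.mass ν univ = Z := by
    rw [Literature.Probability.LatticeModels.mass_univ, hZ]
  have hsum : Z = nE + n0 + n1 + n2 + n01 + n02 + n12 + nT := by
    rw [← hZ, huniv, Finset.sum_insert (by simp), Finset.sum_insert (by simp),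
      Finset.sum_insert (by simp), Finset.sum_insert (by simp), Finset.sum_insert (by simp),
            Finset.sum_insert (by simp),
      Finset.sum_insert (by simp), Finset.sum_singleton, hE, h0, h1, h2, h01, h02, h12, hT]
    ring
  -- FKG products of up-sets
  have fkg : ∀ S S' W : Finset (Fin 3 → Bool), (∀ a b : Fin 3 → Bool, a ≤ b → a ∈ S → b ∈ S) →
      (∀ a b : Fin 3 → Bool, a ≤ b → a ∈ S' → b ∈ S') → S ∩ S' = W →
      (∑ t ∈ S, ν t) * (∑ t ∈ S', ν t) ≤ Z * ∑ t ∈ W, ν t := by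
    rintro S S' W hS hS' rfl
    have h := Literature.Probability.LatticeModels.fkg_upperSet_mass hν0' hν (A := S) (B := S')
      (fun a b hab ha => hS a b hab ha) (fun a b hab ha => hS' a b hab ha)
    rw [hZ'] at h
    exact h
  -- Ahlswede–Daykin trace inequalities
  have ad : ∀ T V W : Finset (Fin 3 → Bool), (∀ a b : Fin 3 → Bool, a ≤ b → a ∈ T → b ∈ T) → T ∩ ({![true, true,
        false], ![true, false, true], ![false, true, true], ![true, true, true]} : Finset (Fin 3 → Bool))ᶜ = V →
      T ∩ ({![true, true, false], ![true, false, true], ![false, true, true], ![true, true,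
            true]} : Finset (Fin 3 → Bool)) = W → (∑ t ∈ ({![true, true, false], ![true, false, true], ![false, true,
            true], ![true, true, true]} : Finset (Fin 3 → Bool)), ν t) * (∑ s ∈ V, ν s) ≤ (∑ s ∈ ({![true, true,
            false], ![true, false, true], ![false, true, true], ![true, true, true]} : Finset (Fin 3 → Bool))ᶜ,
            ν s) * (∑ t ∈ W, ν t) := by
    rintro T V W hT' rfl rfl
    exact SahiE3PatternReduction.mass_U_mul_trace_compl_le hν0' hν (isUpperSet_maj _ rfl) fun a b hab ha => hT' a b
          hab ha
  -- masses of the relevant up-sets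
  have mR0 : ∑ t ∈ ({![true, false, false], ![true, true, false], ![true, false, true], ![true, true,
        true]} : Finset (Fin 3 → Bool)), ν t = n0 + n01 + n02 + nT := by
    rw [Finset.sum_insert (by simp), Finset.sum_insert (by simp), Finset.sum_insert (by simp), Finset.sum_singleton,
      h0, h01, h02, hT]; ring
  have mR1 : ∑ t ∈ ({![false, true, false], ![true, true, false], ![false, true, true], ![true, true,
        true]} : Finset (Fin 3 → Bool)), ν t = n1 + n01 + n12 + nT := by
    rw [Finset.sum_insert (by simp), Finset.sum_insert (by simp), Finset.sum_insert (by simp), Finset.sum_singleton,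
      h1, h01, h12, hT]; ring
  have mR2 : ∑ t ∈ ({![false, false, true], ![true, false, true], ![false, true, true], ![true, true,
        true]} : Finset (Fin 3 → Bool)), ν t = n2 + n02 + n12 + nT := by
    rw [Finset.sum_insert (by simp), Finset.sum_insert (by simp), Finset.sum_insert (by simp), Finset.sum_singleton,
      h2, h02, h12, hT]; ring
  have mP01 : ∑ t ∈ ({![true, true, false], ![true, true, true]} : Finset (Fin 3 → Bool)), ν t = n01 + nT := by
    rw [Finset.sum_insert (by simp), Finset.sum_singleton, h01, hT]
  have mP02 : ∑ t ∈ ({![true, false, true], ![true, true, true]} : Finset (Fin 3 → Bool)), ν t = n02 + nT := by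
    rw [Finset.sum_insert (by simp), Finset.sum_singleton, h02, hT]
  have mP12 : ∑ t ∈ ({![false, true, true], ![true, true, true]} : Finset (Fin 3 → Bool)), ν t = n12 + nT := by
    rw [Finset.sum_insert (by simp), Finset.sum_singleton, h12, hT]
  have mT : ∑ t ∈ ({![true, true, true]} : Finset (Fin 3 → Bool)), ν t = nT := by rw [Finset.sum_singleton, hT]
  have mB0 : ∑ t ∈ ({![true, true, false], ![true, false, true], ![true, true, true]} : Finset (Fin 3 → Bool)),
        ν t = n01 + n02 + nT := by
    rw [Finset.sum_insert (by simp), Finset.sum_insert (by simp), Finset.sum_singleton, h01, h02, hT]; ring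
  have mB1 : ∑ t ∈ ({![true, true, false], ![false, true, true], ![true, true, true]} : Finset (Fin 3 → Bool)),
        ν t = n01 + n12 + nT := by
    rw [Finset.sum_insert (by simp), Finset.sum_insert (by simp), Finset.sum_singleton, h01, h12, hT]; ring
  have mB2 : ∑ t ∈ ({![true, false, true], ![false, true, true], ![true, true, true]} : Finset (Fin 3 → Bool)),
        ν t = n02 + n12 + nT := by
    rw [Finset.sum_insert (by simp), Finset.sum_insert (by simp), Finset.sum_singleton, h02, h12, hT]; ring
  have ma0 : ∑ t ∈ ({![true, false, false]} : Finset (Fin 3 → Bool)), ν t = n0 := by rw [Finset.sum_singleton, h0]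
  have ma1 : ∑ t ∈ ({![false, true, false]} : Finset (Fin 3 → Bool)), ν t = n1 := by rw [Finset.sum_singleton, h1]
  have ma2 : ∑ t ∈ ({![false, false, true]} : Finset (Fin 3 → Bool)), ν t = n2 := by rw [Finset.sum_singleton, h2]
  have mU : ∑ t ∈ ({![true, true, false], ![true, false, true], ![false, true, true], ![true, true,
        true]} : Finset (Fin 3 → Bool)), ν t = n01 + n02 + n12 + nT := by
    rw [Finset.sum_insert (by simp), Finset.sum_insert (by simp), Finset.sum_insert (by simp), Finset.sum_singleton,
      h01, h02, h12, hT]; ring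
  have mD : ∑ t ∈ ({![true, true, false], ![true, false, true], ![false, true, true], ![true, true,
        true]} : Finset (Fin 3 → Bool))ᶜ, ν t = nE + n0 + n1 + n2 := by
    rw [hUc, Finset.sum_insert (by simp), Finset.sum_insert (by simp), Finset.sum_insert (by simp),
          Finset.sum_singleton,
      hE, h0, h1, h2]; ring
  refine ⟨hE ▸ hν0 _, h0 ▸ hν0 _, h1 ▸ hν0 _, h2 ▸ hν0 _, h01 ▸ hν0 _, h02 ▸ hν0 _, h12 ▸ hν0 _, hT ▸ hν0 _,
    hZ ▸ Finset.sum_nonneg fun t _ => hν0 t, hsum,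
    ?_, ?_, ?_, ?_, ?_, ?_, ?_, ?_, ?_, ?_, ?_, ?_, ?_, ?_, ?_, ?_, ?_, ?_, ?_, ?_, ?_⟩
  · have h := pt ![true, false, false] ![false, true, false] ![false, false, false] ![true, true,
        false] (by decide) (by decide); rwa [h0, h1, hE, h01] at h
  · have h := pt ![true, false, false] ![false, false, true] ![false, false, false] ![true, false,
        true] (by decide) (by decide); rwa [h0, h2, hE, h02] at h
  · have h := pt ![false, true, false] ![false, false, true] ![false, false, false] ![false, true,
        true] (by decide) (by decide); rwa [h1, h2, hE, h12] at h
  · have h := pt ![true, false, false] ![false, true, true] ![false, false, false] ![true, true,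
        true] (by decide) (by decide); rwa [h0, h12, hE, hT] at h
  · have h := pt ![false, true, false] ![true, false, true] ![false, false, false] ![true, true,
        true] (by decide) (by decide); rwa [h1, h02, hE, hT] at h
  · have h := pt ![false, false, true] ![true, true, false] ![false, false, false] ![true, true,
        true] (by decide) (by decide); rwa [h2, h01, hE, hT] at h
  · have h := pt ![true, true, false] ![true, false, true] ![true, false, false] ![true, true,
        true] (by decide) (by decide); rwa [h01, h02, h0, hT] at h
  · have h := pt ![true, true, false] ![false, true, true] ![false, true, false] ![true, true,
        true] (by decide) (by decide); rwa [h01, h12, h1, hT] at h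
  · have h := pt ![true, false, true] ![false, true, true] ![false, false, true] ![true, true,
        true] (by decide) (by decide); rwa [h02, h12, h2, hT] at h
  · have h := fkg {![true, false, false], ![true, true, false], ![true, false, true], ![true, true, true]} {![false,
        true, false], ![true, true, false], ![false, true, true], ![true, true, true]} {![true, true, false], ![true,
        true, true]} (by decide) (by decide) (by decide)
    rwa [mR0, mR1, mP01] at h
  · have h := fkg {![true, false, false], ![true, true, false], ![true, false, true], ![true, true, true]} {![false,
        false, true], ![true, false, true], ![false, true, true], ![true, true, true]} {![true, false, true], ![true,
        true, true]} (by decide) (by decide) (by decide)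
    rwa [mR0, mR2, mP02] at h
  · have h := fkg {![false, true, false], ![true, true, false], ![false, true, true], ![true, true, true]} {![false,
        false, true], ![true, false, true], ![false, true, true], ![true, true, true]} {![false, true, true], ![true,
        true, true]} (by decide) (by decide) (by decide)
    rwa [mR1, mR2, mP12] at h
  · have h := fkg {![true, true, false], ![true, true, true]} {![true, false, true], ![true, true, true]} {![true,
        true, true]} (by decide) (by decide) (by decide)
    rwa [mP01, mP02, mT] at h
  · have h := fkg {![true, true, false], ![true, true, true]} {![false, true, true], ![true, true, true]} {![true,
        true, true]} (by decide) (by decide) (by decide)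
    rwa [mP01, mP12, mT] at h
  · have h := fkg {![true, false, true], ![true, true, true]} {![false, true, true], ![true, true, true]} {![true,
        true, true]} (by decide) (by decide) (by decide)
    rwa [mP02, mP12, mT] at h
  · have h := fkg {![true, true, false], ![true, true, true]} {![false, false, true], ![true, false, true], ![false,
        true, true], ![true, true, true]} {![true, true, true]} (by decide) (by decide) (by decide)
    rwa [mP01, mR2, mT] at h
  · have h := fkg {![true, false, true], ![true, true, true]} {![false, true, false], ![true, true, false], ![false,
        true, true], ![true, true, true]} {![true, true, true]} (by decide) (by decide) (by decide)
    rwa [mP02, mR1, mT] at h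
  · have h := fkg {![false, true, true], ![true, true, true]} {![true, false, false], ![true, true, false], ![true,
        false, true], ![true, true, true]} {![true, true, true]} (by decide) (by decide) (by decide)
    rwa [mP12, mR0, mT] at h
  · have h := ad {![true, false, false], ![true, true, false], ![true, false, true], ![true, true, true]} {![true,
        false, false]} {![true, true, false], ![true, false, true], ![true, true,
        true]} (by decide) (by decide) (by decide)
    rwa [mU, ma0, mD, mB0] at h
  · have h := ad {![false, true, false], ![true, true, false], ![false, true, true], ![true, true, true]} {![false,
        true, false]} {![true, true, false], ![false, true, true], ![true, true,
        true]} (by decide) (by decide) (by decide)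
    rwa [mU, ma1, mD, mB1] at h
  · have h := ad {![false, false, true], ![true, false, true], ![false, true, true], ![true, true, true]} {![false,
        false, true]} {![true, false, true], ![false, true, true], ![true, true,
        true]} (by decide) (by decide) (by decide)
    rwa [mU, ma2, mD, mB2] at h

end Summit.CriticalPhenomena.PercolationContinuityZ3.Theorems.SahiE3MajPattern
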